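import Literature.AlgebraicGeometry.Frobenioids.ArchimedeanNonIsotropicAnchors
import Literature.AlgebraicGeometry.Frobenioids.ArchimedeanQuotientLiftingAngular
import Literature.AlgebraicGeometry.Frobenioids.ArchimedeanStandardTypeA
import HarnessLib

/-!
# Frobenioids II, Proposition 3.5 (ii): `C` and `A` are quasi-isotropic — PROVED (under Example 3.3's
# standing hypothesis "`D` totally epimorphic"); Theorem 3.6 (i)(ii) "standard type" closed

Mochizuki, *The geometry of Frobenioids II: poly-Frobenioids*, Kyushu J. Math. **62** (2008) 401–460,
§3, Proposition 3.5 (ii), kurims text p. 34 [cite: MochizukiFrdII2008, Prop 3.5 (ii) p.34]: "The Frobenioid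
`F` is quasi-isotropic, i.e., an object of `F` is non-isotropic if and only if it is an iso-subanchor of
`F`"; proof p. 34 l. 46 – p. 35 l. 27: "it suffices to show that every non-isotropic `A ∈ Ob(F)` is an
iso-subanchor … `A_D` is an RC-iso-subanchor … by (i) … a pull-back morphism `B → A` … a mono-minimal
categorical quotient … `B_D → C_D`, where `C_D` is an RC-anchor … it suffices to prove that `C` is an anchor
of `F`."

PROOF-ONLY companion, part 4 (abc-iut cell, layer L1, node `FrdII:Prop3.5(ii)`, sub-row P35-L04
`NonIsotropicIsIsoSubanchor_reduce` + assembly; seat abc-iut-w4-d092):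
* `NonIso.isIsoSubanchor_of_not_isotropic` — **the «⇒» half for `F = C` over ANY `π : D → D₀` of
  RC-iso-subanchor type** (no total epimorphicity): lift the quotient datum by the REPAIRED Prop. 3.5 (i)
  (`QuotientLift.prop35iR_C_holds`, abc-iut-w4-d100; Galois saturation is automatic over the complex
  `A_D`), push `B` forward to an object over the RC-anchor `C_D`, and apply `NonIso.isAnchor_of_nonIsotropic`;
* `NonIso.A.isAnchor_of_isAnchor_obj` — anchors of `C` underlying objects of `A` are anchors of `A`
  (factorisations in `C` of isometries are factorisations in `A`, `C.isIsometry_of_fac`), and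
  `NonIso.A.isIsoSubanchor_of_not_isotropic` — the «⇒» half for `F = A` (via `QuotientLiftA.prop35iR_A_holds`);
* **`prop35ii_C`, `prop35ii_A`**: `ArchFrd.Prop35ii_C π` / `ArchFrd.Prop35ii_A π` (abc-iut-L1-t9's instance
  statements) PROVED for `D` totally epimorphic — the «⇐» halves are abc-iut-L1-t9's
  `isoSubanchor_not_isotropic_C/_A` ([FrdI] Rmk. 3.1.1), which use that hypothesis;
* **`A.isOfStandardType`, `C.isOfStandardType`**: Thm. 3.6 (ii) "`A` is of standard type" and the
  standard-type conjunct of Thm. 3.6 (i) for `C = C^ℤ`, now closed over every CONNECTED, TOTALLY EPIMORPHIC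
  base `D` (Ex. 3.3 (i), p. 27) of FSMFF- and RC-iso-subanchor type (abc-iut-w4-d092 gen 0's
  `A/C.isOfStandardType_of_prop35ii_of_isGraphConnected` with their Prop. 3.5 (ii) input discharged).
No definitions; no statement of the paper is strengthened; nothing here bears on [IUTchIII] Cor. 3.12.
-/

namespace Literature.AlgebraicGeometry.Frobenioids

open CategoryTheory Set
open scoped Pointwise

noncomputable section

universe v u

namespace ArchFrd

variable {D : Type u} [Category.{v} D] (π : D ⥤ D0)

namespace NonIso

/-! ### `F = C` -/

/-- An object of `C` whose angular region is not isotropic lies over a complex object of `D` (real objects have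
isotropic regions, Def. 3.1 (iii)/(iv)). [cite: MochizukiFrdII2008, Prop 3.5 (ii) p.34] -/
theorem isComplex_snd_of_not_isotropic (X : C π) (hX : ¬ X.fst.region.IsIsotropic) :
    (π.obj X.snd).IsComplex := by
  rcases D0.isReal_or_isComplex (π.obj X.snd) with h | h
  · exact absurd (C0.isNaivelyIsotropic_of_isRealObj ((D0.eq_of_isIso X.iso.hom).trans h)) hX
  · exact h

/-- **Prop. 3.5 (ii) «⇒» for `F = C`**: over a base `π : D → D₀` of RC-iso-subanchor type, every object of
`C = C₀ ×_{D₀} D` whose angular region is not isotropic is an iso-subanchor of `C` (p. 34 l. 46 – p. 35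
l. 27; no total epimorphicity needed for this half). [cite: MochizukiFrdII2008, Prop 3.5 (ii) p.34] -/
theorem isIsoSubanchor_of_not_isotropic (hRC : RC.IsOfRCIsoSubanchorType (baseRC π)) (X : C π)
    (hX : ¬ X.fst.region.IsIsotropic) : IsIsoSubanchor X := by
  have hXc : (π.obj X.snd).IsComplex := isComplex_snd_of_not_isotropic π X hX
  obtain ⟨BD, GD, fD, ⟨CD, ⟨hCDc, hCDa⟩, ⟨gD⟩⟩, hq⟩ := hRC.isRCIsoSubanchor X.snd
  obtain ⟨B, f, e, Γ, -, -, -, -, hqB⟩ :=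
    QuotientLift.prop35iR_C_holds π hRC X BD fD GD hq (galoisSaturated_of_isComplex π fD GD hXc)
  change B ⟶ X at f
  have hB : ¬ B.fst.region.IsIsotropic := fun h => hX (C0.isNaivelyIsotropic_of_hom f.fst h)
  have hCD : (π.obj CD).IsComplex := (D0.complexObjects_comp_iff π CD).mp hCDc
  let h : B.snd ⟶ CD := e.hom ≫ gD
  exact ⟨B, Γ, f, ⟨pushObj π B h hCD, isAnchor_of_nonIsotropic π (pushObj π B h hCD) hB hCDc hCDa,
    ⟨pushHom π B h hCD⟩⟩, hqB⟩

/-! ### `F = A` -/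

namespace A

/-- **An object of `A` is an anchor of `A` as soon as its underlying object is an anchor of `C`**: an
irreducible arrow of `A` is irreducible in `C` (a factorisation in `C` of an isometry is a factorisation by
isometries, `Φ₀ = ℝ_{≥0}` being sharp), and isomorphism classes under `X` in `A` inject into those under `X`
in `C`. [cite: MochizukiFrdII2008, Prop 3.5 (ii) p.34] -/
theorem isAnchor_of_isAnchor_obj (X : ArchFrd.A π) (h : IsAnchor X.obj) : IsAnchor X := by
  -- the class map `^X A → ^{X.obj} C`
  let u : Under X → Under X.obj := fun f => Under.mk f.hom.hom
  have hu : ∀ f f' : Under X, Nonempty (f ≅ f') → Nonempty (u f ≅ u f') := by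
    rintro f f' ⟨i⟩
    exact ⟨Under.isoMk ((A.ι π).mapIso ((Under.forget X).mapIso i))
      (congrArg (fun k => k.hom) (Under.w i.hom))⟩
  let U : Quotient (isIsomorphicSetoid (Under X)) → Quotient (isIsomorphicSetoid (Under X.obj)) :=
    Quotient.map' u hu
  have hU : ∀ f : Under X, U (Quotient.mk _ f) = Quotient.mk _ (u f) := fun f => rfl
  -- irreducible in `A` ⟹ irreducible in `C`
  have hirr : ∀ f : Under X, IsIrreducibleHom f.hom → IsIrreducibleHom f.hom.hom := by
    intro f hf
    refine ⟨fun hi => hf.1 ?_, fun W β α hfac => ?_⟩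
    · haveI := hi; exact A.isIso_of_isIso_hom f.hom
    · have hβα : PreFrobenioid.IsIsometry (C.toElem π) (β ≫ α) := by rw [hfac]; exact f.hom.property
      obtain ⟨hβ, hα⟩ := C.isIsometry_of_fac π β α hβα
      let W' : ArchFrd.A π := ⟨W⟩
      let β' : X ⟶ W' := ⟨β, hβ⟩
      let α' : W' ⟶ f.right := ⟨α, hα⟩
      have hfac' : β' ≫ α' = f.hom := WideSubcategory.hom_ext _ hfac
      rcases hf.2 β' α' hfac' with hi | hi
      · haveI := hi; exact Or.inl (inferInstance : IsIso ((A.ι π).map α'))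
      · haveI := hi; exact Or.inr (inferInstance : IsIso ((A.ι π).map β'))
  -- `U` is injective
  have hinj : Function.Injective U := by
    intro x y hxy
    induction x using Quotient.inductionOn with | h f => ?_
    induction y using Quotient.inductionOn with | h f' => ?_
    rw [hU, hU] at hxy
    obtain ⟨j⟩ := Quotient.exact hxy
    have hw : f.hom.hom ≫ j.hom.right = f'.hom.hom := Under.w j.hom
    haveI : IsIso j.hom.right := (inferInstance : IsIso ((Under.forget X.obj).map j.hom))
    have hjiso : PreFrobenioid.IsIsometry (C.toElem π) j.hom.right :=
      (C.isIsometry_of_fac π f.hom.hom j.hom.right (by rw [hw]; exact f'.hom.property)).2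
    let j' : f.right ⟶ f'.right := ⟨j.hom.right, hjiso⟩
    haveI : IsIso j'.hom := by change IsIso j.hom.right; infer_instance
    haveI : IsIso j' := A.isIso_of_isIso_hom j'
    exact Quotient.sound ⟨Under.isoMk (asIso j') (WideSubcategory.hom_ext _ hw)⟩
  -- finiteness pulled back
  refine Set.Finite.of_finite_image (h.subset ?_) hinj.injOn
  rintro _ ⟨x, ⟨f, hf, rfl⟩, rfl⟩
  exact ⟨u f, hirr f hf, (hU f).symm⟩

/-- **Prop. 3.5 (ii) «⇒» for `F = A`**: over a base `π : D → D₀` of RC-iso-subanchor type, every object of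
the angular Frobenioid `A` whose angular region is not isotropic is an iso-subanchor of `A` (lift by the
repaired Prop. 3.5 (i) for `A`, abc-iut-w4-d100; push forward to an object over the RC-anchor; anchors
transfer from `C` to `A`). [cite: MochizukiFrdII2008, Prop 3.5 (ii) p.34] -/
theorem isIsoSubanchor_of_not_isotropic (hRC : RC.IsOfRCIsoSubanchorType (baseRC π)) (X : ArchFrd.A π)
    (hX : ¬ X.obj.fst.region.IsIsotropic) : IsIsoSubanchor X := by
  have hXc : (π.obj X.obj.snd).IsComplex := isComplex_snd_of_not_isotropic π X.obj hX
  obtain ⟨BD, GD, fD, ⟨CD, ⟨hCDc, hCDa⟩, ⟨gD⟩⟩, hq⟩ := hRC.isRCIsoSubanchor X.obj.snd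
  obtain ⟨B, f, e, Γ, -, -, -, -, hqB⟩ :=
    QuotientLiftA.prop35iR_A_holds π hRC X BD fD GD hq (galoisSaturated_of_isComplex π fD GD hXc)
  change B ⟶ X at f
  have hB : ¬ B.obj.fst.region.IsIsotropic := fun h => hX (C0.isNaivelyIsotropic_of_hom f.hom.fst h)
  have hCD : (π.obj CD).IsComplex := (D0.complexObjects_comp_iff π CD).mp hCDc
  let h : B.obj.snd ⟶ CD := e.hom ≫ gD
  let W : ArchFrd.A π := ⟨pushObj π B.obj h hCD⟩
  have hp : PreFrobenioid.IsIsometry (C.toElem π) (pushHom π B.obj h hCD) := by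
    change PreFrobenioid.IsIsometry C0.toElem (𝟙 B.obj.fst)
    rw [A0.isIsometry_iff_norm_mul_tip_pow, C0.scalar_id', C0.degFr_id', Units.val_one, norm_one, one_mul,
      PNat.one_coe, pow_one]
  let p : B ⟶ W := ⟨pushHom π B.obj h hCD, hp⟩
  exact ⟨B, Γ, f, ⟨W, isAnchor_of_isAnchor_obj π W
    (isAnchor_of_nonIsotropic π (pushObj π B.obj h hCD) hB hCDc hCDa), ⟨p⟩⟩, hqB⟩

end A

end NonIso

/-! ### The instance statements of Proposition 3.5 (ii), and Theorem 3.6 (i)(ii) "standard type" -/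

/-- **Proposition 3.5 (ii) for `F = C` (`= C^ℤ`) — PROVED** for `D` totally epimorphic (Ex. 3.3 (i)'s standing
hypothesis; used only in the «⇐» half, [FrdI] Rmk. 3.1.1, abc-iut-L1-t9): over a base of RC-iso-subanchor
type an object of `C` is non-isotropic iff it is an iso-subanchor of `C`.
[cite: MochizukiFrdII2008, Prop 3.5 (ii) p.34] -/
theorem prop35ii_C (hTE : IsTotallyEpimorphic D) :
    Literature.AlgebraicGeometry.Frobenioids.ArchFrd.Prop35ii_C π := by
  intro hRC X
  constructor
  · intro hX
    exact NonIso.isIsoSubanchor_of_not_isotropic π hRC X (fun h => hX ((Ex33ii_isotropic_iff_holds π X).2 h))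
  · exact isoSubanchor_not_isotropic_C π hTE X

/-- **Proposition 3.5 (ii) for `F = A` — PROVED** for `D` totally epimorphic: over a base of RC-iso-subanchor
type an object of the angular Frobenioid `A` is non-isotropic iff it is an iso-subanchor of `A`.
[cite: MochizukiFrdII2008, Prop 3.5 (ii) p.34] -/
theorem prop35ii_A (hTE : IsTotallyEpimorphic D) :
    Literature.AlgebraicGeometry.Frobenioids.ArchFrd.Prop35ii_A π := by
  intro hRC X
  constructor
  · intro hX
    exact NonIso.A.isIsoSubanchor_of_not_isotropic π hRC X
      (fun h => hX ((Ex33iii_isotropic_iff_holds π X).2 ((Ex33ii_isotropic_iff_holds π X.obj).2 h)))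
  · exact isoSubanchor_not_isotropic_A π hTE X

/-- **Theorem 3.6 (ii), "`A` is of standard type" — PROVED** over every connected, totally epimorphic base
`D` (Ex. 3.3 (i)) of FSMFF- and RC-iso-subanchor type: abc-iut-w4-d092 gen 0's
`A.isOfStandardType_of_prop35ii_of_isGraphConnected` with its Prop. 3.5 (ii) input now discharged.
[cite: MochizukiFrdII2008, Thm 3.6 (ii) p.37] -/
theorem A.isOfStandardType (hconn : IsGraphConnected D) (hTE : IsTotallyEpimorphic D)
    (hD : IsOfFSMFFType D) (hrc : RC.IsOfRCIsoSubanchorType (baseRC π)) :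
    (PreFrobenioidData.ofFunctor (zeroMonoid D : Dᵒᵖ ⥤ CommMonCat.{0}) (A.toElem π)).IsOfStandardType :=
  A.isOfStandardType_of_prop35ii_of_isGraphConnected π hconn hD hrc (prop35ii_A π hTE)

/-- **Theorem 3.6 (i), the "standard type" conjunct for `C = C^ℤ` — PROVED** over every connected, totally
epimorphic base `D` of FSMFF- and RC-iso-subanchor type (gen 0's
`C.isOfStandardType_of_prop35ii_of_isGraphConnected` with Prop. 3.5 (ii) for `C` discharged).
[cite: MochizukiFrdII2008, Thm 3.6 (i) p.36] -/
theorem C.isOfStandardType (hconn : IsGraphConnected D) (hTE : IsTotallyEpimorphic D)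
    (hD : IsOfFSMFFType D) (hrc : RC.IsOfRCIsoSubanchorType (baseRC π)) :
    (PreFrobenioidData.ofFunctor (Φ π) (C.toElem π)).IsOfStandardType :=
  C.isOfStandardType_of_prop35ii_of_isGraphConnected π hconn hD hrc (prop35ii_C π hTE)

end ArchFrd

end

end Literature.AlgebraicGeometry.Frobenioids
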